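import Summits.CriticalPhenomena.Ising3DConformalLimit.Theses.PerfectScreening
import Summits.CriticalPhenomena.Ising3DConformalLimit.Theses.EnergyNotSigmaSquared
import Summits.CriticalPhenomena.Ising3DConformalLimit.Theses.HyperoctahedralRP
import Summits.CriticalPhenomena.Ising3DConformalLimit.Theorems.PerfectScreeningMoebiusLimitExistsTwoLeaf
import Summits.CriticalPhenomena.Ising3DConformalLimit.Theorems.GaussianScaleMixtureRotationUpgradeFromTwoPoint
import Summits.CriticalPhenomena.Ising3DConformalLimit.Theorems.HyperoctahedralRPInversionUpgradeNormalisedLatticeRP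
import Summits.CriticalPhenomena.Ising3DConformalLimit.Theorems.HyperoctahedralRPInversionUpgradeNormalisedGaussianDomination
import Summits.CriticalPhenomena.Ising3DConformalLimit.Theorems.HyperoctahedralRPInversionUpgradeNormalisedPairTruncation
import Summits.CriticalPhenomena.Ising3DConformalLimit.Theorems.HyperoctahedralRPInversionUpgradeNormalisedOSReflectionPositive
import Summits.CriticalPhenomena.Ising3DConformalLimit.Theorems.HyperoctahedralRPInversionUpgradeNormalisedOSLayer
import Summits.CriticalPhenomena.Ising3DConformalLimit.Theorems.HyperoctahedralRPInversionUpgradeNormalisedClustering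
import Summits.CriticalPhenomena.Ising3DConformalLimit.Theorems.InversionUpgradeNormalised.Negative.SharperWindow
import Summits.CriticalPhenomena.Ising3DConformalLimit.Theorems.InversionUpgradeNormalised.Negative.AutomaticOrders
import Literature.Probability.LatticeModels.CriticalWickDichotomy
import Literature.MathematicalPhysics.QuantumFieldTheory.PointwiseOSReconstruction
import HarnessLib

/-!
# Crux `MoebiusLimitExists` (stmt-CriticalPhenomena-1344) and item `InversionUpgradeNormalised` (stmt-1982):
# reduction to the STRICT-WINDOW INTERIOR INVERSION UPGRADE (line `Sketch` v5, lead c11, 2026-08-17)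

Theorem-only glue over landed files (no definitions). Write `Interior(≤)` for the statement of item 1982's registered
stub `stub_interiorInversionUpgrade` (line `free-endpoint-gaussian-closure`) and `Interior(<)` for the same statement
with the STRICT window `1/2 < Δ ≤ 3/4` (= the single registered stub `stub_interiorInversionUpgradeStrict` of line
`Sketch` v5 for crux 1344):

  every normalised, non-degenerate, Euclidean-invariant, scale-covariant pointwise scaling limit `S` of
  `criticalCorr 3` with `Δ` in the window, `HasNontrivialU4 S`, the pointwise OS premises along all three axes and
  clustering in every direction is `IsInversionCovariant Δ`.

Proved here, sorry-free:
* `gaussianFamilyInversionCovariant` — the GAUSSIAN LOCUS is inversion covariant (model-blind: normalised + Euclidean +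
  scale covariant + odd orders vanish + Wick off the diagonals);
* `half_lt_delta_of_hasNontrivialU4` — the FREE ENDPOINT IS EMPTY on the interacting stratum: (H1)–(H6) with
  `U₄ ≢ 0` force `1/2 < Δ` (pointwise Pohlmeyer, by the landed edge machinery of crux stmt-8367: nine-mirror OS
  positivity, exterior harmonicity = OS null vector, analyticity off a finite set, flooding + Bôcher + Liouville);
  this discharges the `FreeEndpointWick` debt recorded by 1982's line;
* `inversionUpgradeNormalised_of_interior : Interior(≤) → InversionUpgradeNormalised` (registered anchor) and
  `inversionUpgradeNormalised_of_interiorStrict : Interior(<) → InversionUpgradeNormalised` — item 1982 follows from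
  the interior stub ALONE: the six other stubs of its line are theorems (`stub_latticeRP` p74549,
  `stub_gaussianDomination` p75645, `stub_pairTruncation` p76600, `stub_osReflectionPositive` p79863, `stub_osLayer`
  p81890, `stub_clustering` = p139062 ∘ p139228 ∘ p139161 ∘ Clustering file, this seat), the window is
  `delta_mem_sharpWindow_of_hyp`, the Gaussian locus and the edge are the bullets above;
* `inversionUpgradeNormalised_iff_interiorStrict : InversionUpgradeNormalised ↔ Interior(<)` — item 1982 IS the
  strict interior stub;
* `MoebiusLimitExists_iff_existence_and_interiorStrict : MoebiusLimitExists ↔ ExistsScaleCovariantLimit ∧ Interior(<)`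
  (two-leaf glue p137285 + the above; also the `EnergyNotSigmaSquared.MoebiusLimit` spelling): after this seat the
  crux is EXACTLY existence (item 1981) ∧ the inversion upgrade on the interacting OPEN-window stratum with OS and
  clustering in hand — "scale + OS ⇒ conformal" for the Ising₃ `σ`-sector, `Δ ∈ (1/2, 3/4]`.
-/

noncomputable section

open Filter Topology Finset
open Literature.Probability.LatticeModels Literature.MathematicalPhysics.QuantumFieldTheory
open EuclideanGeometry

namespace Summit.CriticalPhenomena.Ising3DConformalLimit.MoebiusLimitExistsSketch

open Summit.CriticalPhenomena.Ising3DConformalLimit.Cruxes.InversionUpgradeNormalised.FreeEndpointGaussianClosure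
  (stub_latticeRP stub_gaussianDomination stub_pairTruncation stub_osReflectionPositive stub_osLayer
   stub_clustering)
open Summit.CriticalPhenomena.Ising3DConformalLimit.InversionUpgradeNormalisedNegative
  (two_point_eq two_point_inversion delta_mem_sharpWindow_of_hyp)
open Summit.CriticalPhenomena.Ising3DConformalLimit.Cruxes.RotationUpgradeFromTwoPoint.NullLaplacianEdgeGaussianity
  (stub_nineMirrorRP stub_analyticOffFinite stub_exteriorHarmonic stub_edgeBocherLiouville)

/-! ## The Gaussian locus -/

/-- Reindexing the Kelvin weights of a pairing. [folklore] -/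
theorem prod_pair_weights {α : Type*} (w : α → ℝ) (m : ℕ) (x : Fin (2 * m) → α)
    (τ : Equiv.Perm (Fin (2 * m))) :
    ∏ j : Fin m, (w (x (τ (pairIdx m (j, 0)))) * w (x (τ (pairIdx m (j, 1))))) =
      ∏ i, w (x i) := by
  calc ∏ j : Fin m, (w (x (τ (pairIdx m (j, 0)))) * w (x (τ (pairIdx m (j, 1)))))
      = ∏ j : Fin m, ∏ k : Fin 2, w (x (τ (pairIdx m (j, k)))) := by
        refine Finset.prod_congr rfl fun j _ => ?_
        rw [Fin.prod_univ_two]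
    _ = ∏ p : Fin m × Fin 2, w (x (τ (pairIdx m p))) := by
        rw [← Finset.univ_product_univ, Finset.prod_product]
    _ = ∏ i : Fin (2 * m), w (x (τ i)) :=
        Fintype.prod_equiv (pairIdx m) _ _ fun p => rfl
    _ = ∏ i, w (x i) := Equiv.prod_comp τ (fun i => w (x i))

/-- **The Gaussian locus is inversion covariant** (model-blind): a normalised, Euclidean-invariant,
scale-covariant family on `ℝ³` whose odd correlators vanish and whose even correlators obey Wick's
rule off the diagonals is inversion covariant with the same weight. [folklore] -/
theorem gaussianFamilyInversionCovariant {Δ : ℝ} {S : CorrFamily 3}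
    (hnorm : ∀ n z, z ∉ NonCoincident 3 n → S n z = 0) (heuc : IsEuclideanInvariant S)
    (hsc : IsScaleCovariant Δ S)
    (hodd : ∀ n (x : Fin n → EuclideanSpace ℝ (Fin 3)), Odd n → S n x = 0)
    (hwick : ∀ n, 2 ≤ n → ∀ x ∈ NonCoincident 3 (2 * n),
      S (2 * n) x = pairingSum (fun p q => S 2 ![p, q]) n x) :
    IsInversionCovariant Δ S := by
  intro n x hx0
  set ι : EuclideanSpace ℝ (Fin 3) → EuclideanSpace ℝ (Fin 3) := inversion 0 1 with hι
  have hinj : Function.Injective ι := inversion_injective (0 : EuclideanSpace ℝ (Fin 3)) one_ne_zero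
  obtain ⟨k, rfl | rfl⟩ := Nat.even_or_odd' n
  · by_cases hx : Function.Injective x
    · have hιx : Function.Injective (fun i => ι (x i)) := hinj.comp hx
      rcases k with _ | _ | k
      · have hi : ∀ i : Fin (2 * 0), False := fun i => by have := i.isLt; omega
        have hfun : (fun i => ι (x i)) = x := funext fun i => (hi i).elim
        rw [hfun, Finset.prod_eq_one (fun i _ => (hi i).elim), one_mul]
      · have hx01 : x 0 ≠ x 1 := fun h => absurd (hx h) (by decide)
        have hxv : x = ![x 0, x 1] := by funext i; fin_cases i <;> rfl
        have hιv : (fun i => ι (x i)) = ![ι (x 0), ι (x 1)] := by funext i; fin_cases i <;> rfl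
        rw [hιv, hxv]
        simp only [Matrix.cons_val_zero, Matrix.cons_val_one]
        rw [Fin.prod_univ_two]
        simp only [Matrix.cons_val_zero, Matrix.cons_val_one]
        exact two_point_inversion heuc hsc hx01 (hx0 0) (hx0 1)
      · have hk : 2 ≤ k + 2 := by omega
        rw [hwick (k + 2) hk _ hιx, hwick (k + 2) hk _ hx]
        unfold pairingSum
        rw [Finset.mul_sum, Finset.mul_sum, Finset.mul_sum]
        refine Finset.sum_congr rfl fun τ _ => ?_
        have hterm : ∀ j : Fin (k + 2),
            S 2 ![ι (x (τ (pairIdx (k + 2) (j, 0)))), ι (x (τ (pairIdx (k + 2) (j, 1))))] =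
              (‖x (τ (pairIdx (k + 2) (j, 0)))‖ ^ (2 * Δ) * ‖x (τ (pairIdx (k + 2) (j, 1)))‖ ^ (2 * Δ)) *
                S 2 ![x (τ (pairIdx (k + 2) (j, 0))), x (τ (pairIdx (k + 2) (j, 1)))] := by
          intro j
          have hne : x (τ (pairIdx (k + 2) (j, 0))) ≠ x (τ (pairIdx (k + 2) (j, 1))) := by
            intro h
            have h1 := τ.injective (hx h)
            have h2 := (pairIdx (k + 2)).injective h1
            simp at h2
          rw [two_point_inversion heuc hsc hne (hx0 _) (hx0 _)]
        simp_rw [hterm]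
        rw [Finset.prod_mul_distrib, prod_pair_weights (fun p => ‖p‖ ^ (2 * Δ)) (k + 2) x τ]
        ring
    · have hιx : ¬ Function.Injective (fun i => ι (x i)) := fun h => hx (hinj.of_comp_iff x |>.mp h)
      rw [hnorm _ _ hιx, hnorm _ _ hx, mul_zero]
  · rw [hodd _ _ ⟨k, rfl⟩, hodd _ _ ⟨k, rfl⟩, mul_zero]


/-! ## The free endpoint `Δ = 1/2` is empty on the interacting stratum -/

/-- **The free endpoint is empty on the interacting stratum**.  For a normalised, non-degenerate,
Euclidean-invariant, scale-covariant pointwise scaling limit of `criticalCorr 3` with `U₄ ≢ 0`: `1/2 < Δ`.  At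
`Δ = 1/2` nine-mirror OS positivity (`stub_nineMirrorRP`), exterior harmonicity (`stub_exteriorHarmonic`, an OS null
vector), analyticity off a finite set (`stub_analyticOffFinite`) and flooding + Bôcher + Liouville
(`stub_edgeBocherLiouville`) force `U₄ ≡ 0` — all landed theorems of crux stmt-8367's line. [cite: Pohlmeyer1969, Thm. p. 204] -/
theorem half_lt_delta_of_hasNontrivialU4 {ρ : ℝ → ℝ} {Δ : ℝ} {S : CorrFamily 3}
    (hρ : ∀ δ ∈ Set.Ioc (0:ℝ) 1, 0 < ρ δ) (hlim : HasPointwiseScalingLimit (criticalCorr 3) ρ S)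
    (hnorm : ∀ n z, z ∉ NonCoincident 3 n → S n z = 0) (hnd : IsNondegenerateTwoPoint S)
    (heuc : IsEuclideanInvariant S) (hsc : IsScaleCovariant Δ S) (hU4 : HasNontrivialU4 S) :
    1 / 2 < Δ := by
  have hwin : Δ ∈ Set.Icc (1 / 2 : ℝ) 1 :=
    InversionUpgradeNormalisedNegative.delta_mem_Icc_of_hyp hρ hlim hnd hsc
  have htr : IsTranslationInvariant S := heuc.1
  have hiso : ∀ (R : EuclideanSpace ℝ (Fin 3) ≃ₗᵢ[ℝ] EuclideanSpace ℝ (Fin 3))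
      (x : EuclideanSpace ℝ (Fin 3)), x ≠ 0 → S 2 ![0, R x] = S 2 ![0, x] := by
    intro R x _
    have h := heuc.2 2 R ![0, x]
    rw [← h]
    congr 1
    funext i
    fin_cases i <;> simp
  rcases eq_or_lt_of_le hwin.1 with heq | hlt
  · exfalso
    have hRP := stub_nineMirrorRP ρ S hρ hlim hnorm htr
    have han := stub_analyticOffFinite
      ρ Δ S hρ hlim hnorm hnd htr hsc hRP
    obtain ⟨z, hz, hne⟩ := hU4
    exact hne (stub_edgeBocherLiouville
      ρ Δ S hρ hlim hnorm hnd htr hsc hiso heq.symm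
      (fun y hy => stub_exteriorHarmonic
        ρ Δ S hρ hlim hnorm hnd htr hsc hiso hRP heq.symm 3 y hy)
      (fun y hy => han 3 y hy) z hz)
  · exact hlt

/-! ## The interior inversion upgrade implies item 1982, hence (with item 1981) the crux -/

/-- **Item 1982 from the STRICT-window interior stub alone.**  The OS premises along every axis come from
`stub_osLayer ∘ stub_osReflectionPositive ∘ stub_latticeRP` (growth by `stub_gaussianDomination`), clustering from
`stub_clustering` (fed `stub_gaussianDomination`, `stub_pairTruncation`), the window from
`delta_mem_sharpWindow_of_hyp` sharpened to `1/2 < Δ` by `half_lt_delta_of_hasNontrivialU4` on the interacting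
stratum; on the Gaussian locus `U₄ ≡ 0` Wick holds at all even orders
(`HasPointwiseScalingLimit.eq_pairingSum_of_limitConnectedFour_eq_zero`) and `gaussianFamilyInversionCovariant`
applies. [folklore] -/
theorem inversionUpgradeNormalised_of_interiorStrict
    (h7 : (∀ (ρ : ℝ → ℝ) (Δ : ℝ) (S : CorrFamily 3), (∀ δ ∈ Set.Ioc (0:ℝ) 1, 0 < ρ δ) →
      HasPointwiseScalingLimit (criticalCorr 3) ρ S → (∀ n z, z ∉ NonCoincident 3 n → S n z = 0) →
      IsNondegenerateTwoPoint S → IsEuclideanInvariant S → IsScaleCovariant Δ S →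
      1 / 2 < Δ → Δ ≤ 3 / 4 → HasNontrivialU4 S →
      (∀ τ : Fin 3, PointwiseOSReconstruction τ S) →
      (∀ (n m : ℕ) (x : Fin n → EuclideanSpace ℝ (Fin 3)) (y : Fin m → EuclideanSpace ℝ (Fin 3))
        (v : EuclideanSpace ℝ (Fin 3)), v ≠ 0 →
        Tendsto (fun t : ℝ => S (n + m) (Fin.append x (fun j => y j + t • v)) - S n x * S m y)
          atTop (𝓝 0)) →
      IsInversionCovariant Δ S)) :
    Theses.HyperoctahedralRP.InversionUpgradeNormalised := by
  intro ρ Δ S hρ hlim hnorm hnd heuc hsc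
  have hΔ : Δ ∈ Set.Icc (1 / 2 : ℝ) (3 / 4) := delta_mem_sharpWindow_of_hyp hρ hlim hnd heuc hsc
  have hrp : ∀ τ : Fin 3, IsReflectionPositiveAlong τ S :=
    stub_osReflectionPositive stub_latticeRP ρ S hρ hlim heuc.1
  have hos : ∀ τ : Fin 3, PointwiseOSReconstruction τ S :=
    fun τ => stub_osLayer stub_gaussianDomination ρ Δ S hρ hlim hnorm hnd heuc hsc τ (hrp τ)
  have hcl : ∀ (n m : ℕ) (x : Fin n → EuclideanSpace ℝ (Fin 3))
      (y : Fin m → EuclideanSpace ℝ (Fin 3)) (v : EuclideanSpace ℝ (Fin 3)), v ≠ 0 →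
      Tendsto (fun t : ℝ => S (n + m) (Fin.append x (fun j => y j + t • v)) - S n x * S m y)
        atTop (𝓝 0) :=
    stub_clustering stub_gaussianDomination stub_pairTruncation ρ Δ S hρ hlim hnorm hnd heuc hsc
  have hodd : ∀ n (x : Fin n → EuclideanSpace ℝ (Fin 3)), Odd n → S n x = 0 := by
    intro n x hn
    by_cases hx : x ∈ NonCoincident 3 n
    · exact hlim.eq_zero_of_odd le_rfl hn hx
    · exact hnorm n x hx
  by_cases hU4 : HasNontrivialU4 S
  · exact h7 ρ Δ S hρ hlim hnorm hnd heuc hsc (half_lt_delta_of_hasNontrivialU4 hρ hlim hnorm hnd heuc hsc hU4)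
      hΔ.2 hU4 hos hcl
  · have hU : ∀ z ∈ NonCoincident 3 4, limitConnectedFour S z = 0 := by
      intro z hz
      by_contra hne
      exact hU4 ⟨z, hz, hne⟩
    have hwick : ∀ n, 2 ≤ n → ∀ x ∈ NonCoincident 3 (2 * n),
        S (2 * n) x = pairingSum (fun p q => S 2 ![p, q]) n x :=
      fun n hn x hx => hlim.eq_pairingSum_of_limitConnectedFour_eq_zero le_rfl hU hn hx
    exact gaussianFamilyInversionCovariant hnorm heuc hsc hodd hwick

/-- **Item 1982 from the interior stub of its own line** (`stub_interiorInversionUpgrade`, weak window `1/2 ≤ Δ`;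
registered anchor `inversionUpgradeNormalised_of_interior` of line `Sketch`). [folklore] -/
theorem inversionUpgradeNormalised_of_interior :
    (∀ (ρ : ℝ → ℝ) (Δ : ℝ) (S : CorrFamily 3), (∀ δ ∈ Set.Ioc (0:ℝ) 1, 0 < ρ δ) →
      HasPointwiseScalingLimit (criticalCorr 3) ρ S → (∀ n z, z ∉ NonCoincident 3 n → S n z = 0) →
      IsNondegenerateTwoPoint S → IsEuclideanInvariant S → IsScaleCovariant Δ S →
      1 / 2 ≤ Δ → Δ ≤ 3 / 4 → HasNontrivialU4 S →
      (∀ τ : Fin 3, PointwiseOSReconstruction τ S) →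
      (∀ (n m : ℕ) (x : Fin n → EuclideanSpace ℝ (Fin 3)) (y : Fin m → EuclideanSpace ℝ (Fin 3))
        (v : EuclideanSpace ℝ (Fin 3)), v ≠ 0 →
        Tendsto (fun t : ℝ => S (n + m) (Fin.append x (fun j => y j + t • v)) - S n x * S m y)
          atTop (𝓝 0)) →
      IsInversionCovariant Δ S) →
    Summit.CriticalPhenomena.Ising3DConformalLimit.Theses.HyperoctahedralRP.InversionUpgradeNormalised :=
  fun h7 => inversionUpgradeNormalised_of_interiorStrict
    (fun ρ Δ S hρ hlim hnorm hnd heuc hsc hlt => h7 ρ Δ S hρ hlim hnorm hnd heuc hsc hlt.le)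

/-- **Item 1982 IS the strict interior stub** (the converse merely drops hypotheses). [folklore] -/
theorem inversionUpgradeNormalised_iff_interiorStrict :
    Theses.HyperoctahedralRP.InversionUpgradeNormalised ↔
    (∀ (ρ : ℝ → ℝ) (Δ : ℝ) (S : CorrFamily 3), (∀ δ ∈ Set.Ioc (0:ℝ) 1, 0 < ρ δ) →
      HasPointwiseScalingLimit (criticalCorr 3) ρ S → (∀ n z, z ∉ NonCoincident 3 n → S n z = 0) →
      IsNondegenerateTwoPoint S → IsEuclideanInvariant S → IsScaleCovariant Δ S →
      1 / 2 < Δ → Δ ≤ 3 / 4 → HasNontrivialU4 S →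
      (∀ τ : Fin 3, PointwiseOSReconstruction τ S) →
      (∀ (n m : ℕ) (x : Fin n → EuclideanSpace ℝ (Fin 3)) (y : Fin m → EuclideanSpace ℝ (Fin 3))
        (v : EuclideanSpace ℝ (Fin 3)), v ≠ 0 →
        Tendsto (fun t : ℝ => S (n + m) (Fin.append x (fun j => y j + t • v)) - S n x * S m y)
          atTop (𝓝 0)) →
      IsInversionCovariant Δ S) :=
  ⟨fun h ρ Δ S hρ hlim hnorm hnd heuc hsc _ _ _ _ _ => h ρ Δ S hρ hlim hnorm hnd heuc hsc,
    inversionUpgradeNormalised_of_interiorStrict⟩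

/-- Item 1982 is also equivalent to the weak-window interior stub of its own line. [folklore] -/
theorem inversionUpgradeNormalised_iff_interior :
    Theses.HyperoctahedralRP.InversionUpgradeNormalised ↔
    (∀ (ρ : ℝ → ℝ) (Δ : ℝ) (S : CorrFamily 3), (∀ δ ∈ Set.Ioc (0:ℝ) 1, 0 < ρ δ) →
      HasPointwiseScalingLimit (criticalCorr 3) ρ S → (∀ n z, z ∉ NonCoincident 3 n → S n z = 0) →
      IsNondegenerateTwoPoint S → IsEuclideanInvariant S → IsScaleCovariant Δ S →
      1 / 2 ≤ Δ → Δ ≤ 3 / 4 → HasNontrivialU4 S →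
      (∀ τ : Fin 3, PointwiseOSReconstruction τ S) →
      (∀ (n m : ℕ) (x : Fin n → EuclideanSpace ℝ (Fin 3)) (y : Fin m → EuclideanSpace ℝ (Fin 3))
        (v : EuclideanSpace ℝ (Fin 3)), v ≠ 0 →
        Tendsto (fun t : ℝ => S (n + m) (Fin.append x (fun j => y j + t • v)) - S n x * S m y)
          atTop (𝓝 0)) →
      IsInversionCovariant Δ S) :=
  ⟨fun h ρ Δ S hρ hlim hnorm hnd heuc hsc _ _ _ _ _ => h ρ Δ S hρ hlim hnorm hnd heuc hsc,
    inversionUpgradeNormalised_of_interior⟩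

/-- **The crux from existence (item 1981) and the strict interior inversion upgrade** — line `Sketch` v5
composition through the landed two-leaf glue `MoebiusLimitExists_of_leaves` (rotations by `LimitRotationInvariant_of`).
[folklore] -/
theorem MoebiusLimitExists_of_existence_of_interiorStrict
    (hE : Theses.HyperoctahedralRP.ExistsScaleCovariantLimit)
    (h7 : (∀ (ρ : ℝ → ℝ) (Δ : ℝ) (S : CorrFamily 3), (∀ δ ∈ Set.Ioc (0:ℝ) 1, 0 < ρ δ) →
      HasPointwiseScalingLimit (criticalCorr 3) ρ S → (∀ n z, z ∉ NonCoincident 3 n → S n z = 0) →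
      IsNondegenerateTwoPoint S → IsEuclideanInvariant S → IsScaleCovariant Δ S →
      1 / 2 < Δ → Δ ≤ 3 / 4 → HasNontrivialU4 S →
      (∀ τ : Fin 3, PointwiseOSReconstruction τ S) →
      (∀ (n m : ℕ) (x : Fin n → EuclideanSpace ℝ (Fin 3)) (y : Fin m → EuclideanSpace ℝ (Fin 3))
        (v : EuclideanSpace ℝ (Fin 3)), v ≠ 0 →
        Tendsto (fun t : ℝ => S (n + m) (Fin.append x (fun j => y j + t • v)) - S n x * S m y)
          atTop (𝓝 0)) →
      IsInversionCovariant Δ S)) :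
    Theses.PerfectScreening.MoebiusLimitExists :=
  MoebiusLimitExistsTwoLeaf.MoebiusLimitExists_of_leaves hE (inversionUpgradeNormalised_of_interiorStrict h7)

/-- **EXACT RESIDUAL of the crux after this seat**: `MoebiusLimitExists ↔ ExistsScaleCovariantLimit ∧ Interior(<)`
(two-leaf glue `MoebiusLimitExists_iff_leaves` + `inversionUpgradeNormalised_iff_interiorStrict`). [folklore] -/
theorem MoebiusLimitExists_iff_existence_and_interiorStrict :
    Theses.PerfectScreening.MoebiusLimitExists ↔
      Theses.HyperoctahedralRP.ExistsScaleCovariantLimit ∧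
      (∀ (ρ : ℝ → ℝ) (Δ : ℝ) (S : CorrFamily 3), (∀ δ ∈ Set.Ioc (0:ℝ) 1, 0 < ρ δ) →
      HasPointwiseScalingLimit (criticalCorr 3) ρ S → (∀ n z, z ∉ NonCoincident 3 n → S n z = 0) →
      IsNondegenerateTwoPoint S → IsEuclideanInvariant S → IsScaleCovariant Δ S →
      1 / 2 < Δ → Δ ≤ 3 / 4 → HasNontrivialU4 S →
      (∀ τ : Fin 3, PointwiseOSReconstruction τ S) →
      (∀ (n m : ℕ) (x : Fin n → EuclideanSpace ℝ (Fin 3)) (y : Fin m → EuclideanSpace ℝ (Fin 3))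
        (v : EuclideanSpace ℝ (Fin 3)), v ≠ 0 →
        Tendsto (fun t : ℝ => S (n + m) (Fin.append x (fun j => y j + t • v)) - S n x * S m y)
          atTop (𝓝 0)) →
      IsInversionCovariant Δ S) := by
  rw [MoebiusLimitExistsTwoLeaf.MoebiusLimitExists_iff_leaves, inversionUpgradeNormalised_iff_interiorStrict]

/-- The same residual for the primary route's spelling `EnergyNotSigmaSquared.MoebiusLimit` (one term). [folklore] -/
theorem MoebiusLimit_iff_existence_and_interiorStrict :
    Theses.EnergyNotSigmaSquared.MoebiusLimit ↔
      Theses.HyperoctahedralRP.ExistsScaleCovariantLimit ∧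
      (∀ (ρ : ℝ → ℝ) (Δ : ℝ) (S : CorrFamily 3), (∀ δ ∈ Set.Ioc (0:ℝ) 1, 0 < ρ δ) →
      HasPointwiseScalingLimit (criticalCorr 3) ρ S → (∀ n z, z ∉ NonCoincident 3 n → S n z = 0) →
      IsNondegenerateTwoPoint S → IsEuclideanInvariant S → IsScaleCovariant Δ S →
      1 / 2 < Δ → Δ ≤ 3 / 4 → HasNontrivialU4 S →
      (∀ τ : Fin 3, PointwiseOSReconstruction τ S) →
      (∀ (n m : ℕ) (x : Fin n → EuclideanSpace ℝ (Fin 3)) (y : Fin m → EuclideanSpace ℝ (Fin 3))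
        (v : EuclideanSpace ℝ (Fin 3)), v ≠ 0 →
        Tendsto (fun t : ℝ => S (n + m) (Fin.append x (fun j => y j + t • v)) - S n x * S m y)
          atTop (𝓝 0)) →
      IsInversionCovariant Δ S) :=
  MoebiusLimitExists_iff_existence_and_interiorStrict

end Summit.CriticalPhenomena.Ising3DConformalLimit.MoebiusLimitExistsSketch

end
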